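import Summits.ResolutionOfSingularities.ResolutionOfSingularities.Theses.DefectlessFrames
import Summits.ResolutionOfSingularities.ResolutionOfSingularities.Theorems.DefectlessFramesDefectlessFramesRefutation
import Literature.AlgebraicGeometry.Resolution.ResolutionLU

/-!
# Disproof of `ZariskiCMEngine` (stmt-ResolutionOfSingularities-17922) — standing disprover's work file

Crux (route `DefectlessFrames`, rank 6, rev 3):
`ZariskiCMEngine := DefectlessFramesR → PureTranscendentalFrames → RankOneZeroDimUniformization`
— the PORT of Zariski 1940 A.IV/B/C with the Cutkosky–Mourtada 2019 endgame, typed as a bare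
implication from the two frame hypotheses (DF, PT) to relative local uniformization at RANK-ONE
ZERO-DIMENSIONAL valuation rings over PERFECT ground fields of characteristic `p`.

## Findings (cycle 1, 2026-08-17, refuter-cdisprove-…-17922-0) — NO KILL; everything below is `lean check` rc 0, 0 sorries

* §0 WHY IT RESISTS (proved): `engine_of_target`, `target_of_summit`, `engine_of_summit`,
  `not_engine_iff : ¬E ↔ DF ∧ PT ∧ ¬Target`. The conclusion is a slice of `LUrel_p`, implied by
  the summit (tree `lurel_of_resolutionInChar`); an unconditional `¬E` is a counterexample to
  local uniformization (open only in `trdeg ≥ 4`; `trdeg ≤ 3` is Cossart–Piltant, not in tree).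
  No finite / degenerate / small-model refutation of E exists. The only way E can become
  WORTHLESS is the rev-2 way: a refutation of DF or PT makes it provable ex falso — so the
  disprover's real targets are the two antecedents (§3) and the lines' stubs (§4).
* §1 the standing witness `k = 𝔽₂`, `K = 𝔽₂(X)`, `O = 𝔽₂[X]_{(X)}` with its four hypothesis
  lemmas (`const_mem_OX`, `rankOne_OX`, `zeroDim_OX`, `fg_top`) extracted from the tree refutation
  `Theorems/DefectlessFramesDefectlessFramesRefutation.lean` for reuse by every seat.
* §2 LOAD-BEARING ANALYSIS (theorems): DF / PT — untestable (`not_engineWithoutDF_iff`,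
  `not_engineWithoutPT_iff`); `k ⊆ O` REDUNDANT in the target (`targetNoConst_iff`); `R.FG`
  LOAD-BEARING (`not_target_without_rfg`, witness `R = O`, via Jacobson rings) and `R ⊆ O`
  LOAD-BEARING (`not_target_without_rle`); the ALGEBRAIC corner (`n = 0` of DF, `trdeg 0` of the
  target) is EMPTY (`targetHyps_false_of_isAlgebraic`: `RankOne ∋ IsNontrivial`;
  `df_frame_zero_vacuous` at DF's own binder shapes via `isAlgebraic_of_frame_zero`) — certifies
  the rev-3 repair; `p.Prime`, `PerfectField`, `RankOne`, zero-dim: dropping gives larger LU slices,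
  not refutable (they are load-bearing for the MECHANISM only). Landing:
  `Theorems/ZariskiCMEngine/Negative/TargetLoadBearing.lean` (proposal id in NOTES/HANDOFF).
* §3 THE ANTECEDENTS DF / PT (docstring analysis, no cheap kill): see the section docblock —
  dependent Artin–Schreier defect is NOT an obstruction to DF (explicit re-framing), the content
  of DF is "some separable polynomial projection from inside `O` is defectless at `O` with
  controlled axis order" = a Kuhlmann-type open question, NOT decidable by the route header's
  proposed finite key-polynomial computation (a refutation must defeat ALL dominating frames);
  PT is automatic for `n ≤ 1` and its content starts at frames of `≥ 3` elements.
* §4 CANDIDATE STUBS (the round-1 ideas' typed first lemmas): `AttainedDistanceOfDefectless`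
  (card `henselized-frame-valuation-basis`) is **FALSE as typed** — `not_attainedDistanceOfDefectless`
  (direction of `≤` inverted; repaired C′ = `AttainedDistanceOfDefectless'`, untouched by the
  witness, `attainedDistanceOfDefectless'_self`). Landing:
  `Theorems/ZariskiCMEngine/Negative/AttainedDistanceOfDefectlessFalse.lean`.
  `ValuationBasisBestApprox` (card `valuation-basis-best-approximant`) — direction right, true;
  `EtaleAscentRelLU` (card `inertial-peeling-etale-descent`) — true in substance (KK09 Lemma 3.7),
  with a CAUTION on its prose axis-order identity (`κ(v|k(y)) ⊋ k(ȳ)` is possible);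
  `RationalEngine` / `RationalPushDown` (card `rational-absorption-pushdown`) — summit-implied,
  irrefutable.
* `-- Targets`: none yet (no skeleton / PICKED line at this cycle).
* §5 regimes tried and why each fails to bite; what WOULD kill (docblock at the end).
-/

set_option linter.dupNamespace false

open scoped Polynomial
open IsDedekindDomain.HeightOneSpectrum

namespace Summit.ResolutionOfSingularities.ResolutionOfSingularities.Cruxes.ZariskiCMEngine.Disproof

open Summit.ResolutionOfSingularities.ResolutionOfSingularities.Theses.DefectlessFrames
open Summit.ResolutionOfSingularities.ResolutionOfSingularities.Theorems.DefectlessFramesRefutation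

noncomputable section

/-! ## §1 The standing witness: `k = 𝔽₂`, `K = 𝔽₂(X)`, `O = 𝔽₂[X]_{(X)}` (rank one, zero-dimensional)

The abbreviations `kW`, `KW`, `vX`, `OX` are the tree's
(`Theorems/DefectlessFramesDefectlessFramesRefutation.lean`); the four hypothesis-discharging
facts below are extracted from that refutation's proof as reusable lemmas. -/

/-- `X ∈ O`. [folklore] -/
theorem X_mem_OX : (RatFunc.X : KW) ∈ OX := by
  rw [Valuation.mem_valuationSubring_iff]
  change vX RatFunc.X ≤ 1
  rw [Polynomial.valuation_X_eq_neg_one, ← WithZero.exp_zero, WithZero.exp_le_exp]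
  decide

/-- `X⁻¹ ∉ O` (the valuation is non-trivial on `K`). [folklore] -/
theorem inv_X_not_mem_OX : (RatFunc.X : KW)⁻¹ ∉ OX := by
  rw [Valuation.mem_valuationSubring_iff, map_inv₀]
  change ¬ (vX RatFunc.X)⁻¹ ≤ 1
  rw [Polynomial.valuation_X_eq_neg_one, ← WithZero.exp_neg, ← WithZero.exp_zero,
    WithZero.exp_le_exp]
  decide

/-- Constants lie in `O`. [folklore] -/
theorem const_mem_OX : ∀ c : kW, algebraMap kW KW c ∈ OX := by
  intro c
  rw [Valuation.mem_valuationSubring_iff, IsScalarTower.algebraMap_apply kW kW[X] KW]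
  exact valuation_le_one _ _

/-- The valuation of `O` is equivalent to the `X`-adic valuation. [folklore] -/
theorem isEquiv_OX : vX.IsEquiv OX.valuation := Valuation.isEquiv_valuation_valuationSubring _

/-- `O` is of rank one. [folklore] -/
theorem rankOne_OX : Nonempty OX.valuation.RankOne := by
  haveI : OX.valuation.IsNontrivial := by
    refine ⟨RatFunc.X, ?_, ?_⟩
    · simp [RatFunc.X_ne_zero]
    · intro h1
      have := (isEquiv_OX.symm.eq_one_iff_eq_one).mp h1
      simp [Polynomial.valuation_X_eq_neg_one] at this
  rw [Valuation.nonempty_rankOne_iff_mulArchimedean]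
  haveI h1 : MulArchimedean (MonoidWithZeroHom.ValueGroup₀ (.ofClass vX)) :=
    MulArchimedean.comap MonoidWithZeroHom.ValueGroup₀.embedding.toMonoidHom
      MonoidWithZeroHom.ValueGroup₀.embedding_strictMono
  exact MulArchimedean.comap (isEquiv_OX.symm.orderMonoidIso).toMonoidHom
    (isEquiv_OX.symm.orderMonoidIso).strictMono

/-- `O` is zero-dimensional: every element of `O` is a root modulo `𝔪_O` of a non-zero
polynomial over `k` (indeed congruent to a constant). [folklore] -/
theorem zeroDim_OX : ∀ x ∈ OX, ∃ f : Polynomial kW, f ≠ 0 ∧ Polynomial.aeval x f ∈ OX.nonunits := by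
  intro x hx
  rw [Valuation.mem_valuationSubring_iff] at hx
  have hd : x.denom ≠ 0 := RatFunc.denom_ne_zero x
  have hd' : algebraMap kW[X] KW x.denom ≠ 0 := RatFunc.algebraMap_ne_zero hd
  have hd0 : x.denom.coeff 0 ≠ 0 := by
    intro h0
    have hXd : Polynomial.X ∣ x.denom := Polynomial.X_dvd_iff.mpr h0
    have hvd : (Polynomial.idealX kW).intValuation x.denom < 1 :=
      (intValuation_lt_one_iff_mem _ _).mpr
        (by rw [Polynomial.idealX_span]; exact Ideal.mem_span_singleton.mpr hXd)
    have hXn : ¬ Polynomial.X ∣ x.num := by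
      intro hXn
      obtain ⟨a, b, hab⟩ := RatFunc.isCoprime_num_denom x
      have : Polynomial.X ∣ (1 : kW[X]) := hab ▸ dvd_add (dvd_mul_of_dvd_right hXn a)
        (dvd_mul_of_dvd_right hXd b)
      exact Polynomial.not_isUnit_X (isUnit_of_dvd_one this)
    have hvn : (Polynomial.idealX kW).intValuation x.num = 1 :=
      intValuation_eq_one_iff.mpr
        (by rw [Polynomial.idealX_span]; exact fun h => hXn (Ideal.mem_span_singleton.mp h))
    have hvx : vX x = 1 / (Polynomial.idealX kW).intValuation x.denom := by
      conv_lhs => rw [← RatFunc.num_div_denom x]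
      rw [map_div₀, valuation_of_algebraMap, valuation_of_algebraMap, hvn]
    have hpos : 0 < (Polynomial.idealX kW).intValuation x.denom :=
      zero_lt_iff.mpr (intValuation_ne_zero _ _ hd)
    have : 1 < vX x := by
      rw [hvx, one_div, one_lt_inv₀ hpos]; exact hvd
    exact absurd hx (not_le.mpr this)
  have hvd : (Polynomial.idealX kW).intValuation x.denom = 1 :=
    intValuation_eq_one_iff.mpr (by
      rw [Polynomial.idealX_span]
      exact fun h => hd0 (Polynomial.X_dvd_iff.mp (Ideal.mem_span_singleton.mp h)))
  set c : kW := x.num.coeff 0 / x.denom.coeff 0 with hc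
  refine ⟨Polynomial.X - Polynomial.C c, Polynomial.X_sub_C_ne_zero c, ?_⟩
  rw [ValuationSubring.mem_nonunits_iff, ← isEquiv_OX.lt_one_iff_lt_one]
  simp only [map_sub, Polynomial.aeval_X, Polynomial.aeval_C]
  have hx' : x - algebraMap kW KW c =
      algebraMap kW[X] KW (x.num - Polynomial.C c * x.denom) / algebraMap kW[X] KW x.denom := by
    rw [map_sub, map_mul, sub_div, mul_div_assoc, div_self hd', mul_one,
      IsScalarTower.algebraMap_apply kW kW[X] KW c, Polynomial.algebraMap_eq, RatFunc.num_div_denom]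
  rw [hx', map_div₀, valuation_of_algebraMap, valuation_of_algebraMap, hvd, div_one,
    intValuation_lt_one_iff_mem, Polynomial.idealX_span, Ideal.mem_span_singleton,
    Polynomial.X_dvd_iff]
  simp [hc, div_mul_cancel₀ _ hd0]

/-- `K = k(X)` is finitely generated over `k`. [folklore] -/
theorem fg_top : (⊤ : IntermediateField kW KW).FG := ⟨{RatFunc.X}, by simp [RatFunc.adjoin_X]⟩

/-- `O` as a `k`-subalgebra of `K`. [folklore] -/
def OXalg : Subalgebra kW KW := { OX.toSubring with algebraMap_mem' := const_mem_OX }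

theorem mem_OXalg_iff (x : KW) : x ∈ OXalg ↔ x ∈ OX := Iff.rfl


/-! ## §0 Shape of the crux: why it resists

`ZariskiCMEngine := DefectlessFramesR → PureTranscendentalFrames → RankOneZeroDimUniformization`
(`Iff.rfl`). Its conclusion is relative local uniformization at rank-one zero-dimensional
valuation rings over perfect ground fields — a slice of `LUrel_p`, which the summit implies
(tree `lurel_of_resolutionInChar`). Hence NO unconditional `¬ ZariskiCMEngine` exists short of a
counterexample to local uniformization (open only from transcendence degree `4` on), and every
mutation of the crux that keeps a summit-implied conclusion is equally irrefutable. -/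

/-- The crux is implied by its own conclusion (an implication is weaker than its consequent).
[folklore] -/
theorem engine_of_target (h : RankOneZeroDimUniformization) : ZariskiCMEngine := fun _ _ => h

/-- **Why it resists.** A refutation of the crux is EXACTLY: both frame hypotheses hold and
rank-one zero-dimensional local uniformization over perfect fields fails. [folklore] -/
theorem not_engine_iff :
    ¬ ZariskiCMEngine ↔
      DefectlessFramesR ∧ PureTranscendentalFrames ∧ ¬ RankOneZeroDimUniformization := by
  constructor
  · intro h
    by_contra h'
    exact h fun hDF hPT => by_contra fun hT => h' ⟨hDF, hPT, hT⟩
  · rintro ⟨hDF, hPT, hT⟩ h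
    exact hT (h hDF hPT)

/-- Under the two frame hypotheses the crux IS its target (the "conditional target" reading of
the birth vet). [folklore] -/
theorem engine_iff_target_of_frames (hDF : DefectlessFramesR) (hPT : PureTranscendentalFrames) :
    ZariskiCMEngine ↔ RankOneZeroDimUniformization :=
  ⟨fun h => h hDF hPT, fun h _ _ => h⟩

/-- The target (hence the crux) follows from the summit: tree `lurel_of_resolutionInChar`
specialised to rank-one zero-dimensional valuation rings over perfect fields (the extra
hypotheses are simply not used). This is support item `TargetOfResolution` (stmt-18877) — a
prover's to land; recorded here only to certify irrefutability. [folklore] -/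
theorem target_of_summit (h : _root_.ResolutionOfSingularities) : RankOneZeroDimUniformization := by
  intro p hp k K _ _ _ _ _ hfg O hk _ _ R hR hRO
  exact Literature.AlgebraicGeometry.Resolution.lurel_of_resolutionInChar p hp (h p hp) k K hfg O
    hk R hR hRO

/-- `summit → crux`. [folklore] -/
theorem engine_of_summit (h : _root_.ResolutionOfSingularities) : ZariskiCMEngine :=
  engine_of_target (target_of_summit h)

/-! ## §2 Load-bearing analysis of the crux's hypotheses

The crux's hypotheses are (i) the two frame statements `DefectlessFramesR` (DF),
`PureTranscendentalFrames` (PT) and (ii), after unfolding the target, the binders of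
`RankOneZeroDimUniformization`: `p.Prime`, `CharP k p`, `PerfectField k`, `(⊤ : IntermediateField k K).FG`,
`hk : k ⊆ O`, `Nonempty O.valuation.RankOne`, zero-dimensionality, `R.FG`, `R ⊆ O`.

* DF, PT: dropping either leaves `… → RankOneZeroDimUniformization`, still summit-implied —
  NOT testable (`not_engineWithoutDF_iff`, `not_engineWithoutPT_iff`: a proof that either is
  load-bearing is a disproof of local uniformization).
* `p.Prime` / `CharP`: composite `p ≠ 0` admits no field, `p = 0` is Zariski 1940 (char 0, true, not
  in the tree) — not load-bearing, not refutable.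
* `PerfectField k`, `RankOne`, zero-dimensionality: dropping any of them gives a LARGER slice of
  `LUrel_p` (all believed true; `LUrel_p` restricted to zero-dimensional `O` is even EQUIVALENT to
  `LUrel_p`, sibling disproof `Cruxes/PatchingRel/Disproof.lean` (H8) `lurelZeroDim_iff`) — not
  testable. They are load-bearing for the MECHANISM (rank one: density of `k(y')` in its
  henselization and CM Thm 7.1; zero-dim: centres are closed points; perfect: separable residue
  extensions), not for the truth of the statement.
* `hk : k ⊆ O` — REDUNDANT (`targetNoConst_iff`): it follows from `R ⊆ O` for any `k`-subalgebra `R`.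
  (In DF/PT it is used to define the reduction map `ρ`, so it must stay there.)
* `R.FG` — LOAD-BEARING (`not_target_without_rfg`): at the witness `O = 𝔽₂[X]_{(X)}` take `R = O`.
* `R ⊆ O` — LOAD-BEARING (`not_target_without_rle`): `R = 𝔽₂[X⁻¹]`.
* `(⊤ : IntermediateField k K).FG` — presumably load-bearing exactly like tree
  `not_lurel_without_fg`, but a rank-one zero-dimensional `O` on a NON-finitely generated `K` is
  not constructed in the tree; not attempted (low information).
* The corner `K/k` algebraic (which is the `n = 0` corner of DF with `f ≠ 0`, and the `trdeg 0`
  corner of the target) is VACUOUS: `RankOne ∋ IsNontrivial` excludes it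
  (`targetHyps_false_of_isAlgebraic`). This certifies the rev-3 repair of the lever. -/

/-- The crux with DF dropped. -/
def EngineWithoutDF : Prop := PureTranscendentalFrames → RankOneZeroDimUniformization

/-- The crux with PT dropped. -/
def EngineWithoutPT : Prop := DefectlessFramesR → RankOneZeroDimUniformization

/-- Refuting the DF-less engine = proving PT and disproving LU. Not available. [folklore] -/
theorem not_engineWithoutDF_iff :
    ¬ EngineWithoutDF ↔ PureTranscendentalFrames ∧ ¬ RankOneZeroDimUniformization := by
  unfold EngineWithoutDF; tauto

/-- Refuting the PT-less engine = proving DF and disproving LU. Not available. [folklore] -/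
theorem not_engineWithoutPT_iff :
    ¬ EngineWithoutPT ↔ DefectlessFramesR ∧ ¬ RankOneZeroDimUniformization := by
  unfold EngineWithoutPT; tauto

/-- The target with the hypothesis `k ⊆ O` dropped. -/
def TargetNoConst : Prop :=
  ∀ p : ℕ, p.Prime → ∀ (k K : Type) [Field k] [CharP k p] [PerfectField k] [Field K] [Algebra k K],
    (⊤ : IntermediateField k K).FG → ∀ O : ValuationSubring K,
      Nonempty O.valuation.RankOne →
        (∀ x ∈ O, ∃ f : Polynomial k, f ≠ 0 ∧ Polynomial.aeval x f ∈ O.nonunits) →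
          ∀ R : Subalgebra k K, R.FG → R.toSubring ≤ O.toSubring →
            ∃ (A : Subalgebra k K) (h : A.toSubring ≤ O.toSubring), R ≤ A ∧ A.FG ∧
              IsFractionRing A K ∧ IsRegularLocalRing (Localization.AtPrime
                (Ideal.comap (Subring.inclusion h) (IsLocalRing.maximalIdeal O)))

/-- (H2) **`k ⊆ O` is redundant in the target**: it follows from `R ⊆ O`. [folklore] -/
theorem targetNoConst_iff : TargetNoConst ↔ RankOneZeroDimUniformization := by
  constructor
  · intro H p hp k K _ _ _ _ _ hfg O _ hr hz R hR hRO
    exact H p hp k K hfg O hr hz R hR hRO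
  · intro H p hp k K _ _ _ _ _ hfg O hr hz R hR hRO
    exact H p hp k K hfg O (fun c => hRO (R.algebraMap_mem c)) hr hz R hR hRO

/-- (H9) **`R.FG` is load-bearing in the target**: relative LU demanded for ALL `k`-subalgebras
`R ⊆ O` fails — witness `k = 𝔽₂`, `K = 𝔽₂(X)`, `O = 𝔽₂[X]_{(X)}` (rank one, zero-dimensional),
`R = O`: a finitely generated `A` with `O ≤ A ⊆ O` makes `O` a finitely generated `𝔽₂`-algebra,
hence a Jacobson ring; being a local domain its maximal ideal is then `Jac(⊥) = ⊥`, but it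
contains `X ≠ 0`. (So the crux with this antecedent-free target would be FALSE only if DF ∧ PT were
proved; the lemma's use is to tell the prover that the engine must exploit finite generation of
the prescribed ring — Zariski's A.IV immersion of `R` into a hypersurface frame.) [folklore] -/
theorem not_target_without_rfg :
    ¬ ∀ p : ℕ, p.Prime → ∀ (k K : Type) [Field k] [CharP k p] [PerfectField k] [Field K]
      [Algebra k K], (⊤ : IntermediateField k K).FG → ∀ O : ValuationSubring K,
        (∀ c : k, algebraMap k K c ∈ O) → Nonempty O.valuation.RankOne →
          (∀ x ∈ O, ∃ f : Polynomial k, f ≠ 0 ∧ Polynomial.aeval x f ∈ O.nonunits) →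
            ∀ R : Subalgebra k K, R.toSubring ≤ O.toSubring →
              ∃ (A : Subalgebra k K) (h : A.toSubring ≤ O.toSubring), R ≤ A ∧ A.FG ∧
                IsFractionRing A K ∧ IsRegularLocalRing (Localization.AtPrime
                  (Ideal.comap (Subring.inclusion h) (IsLocalRing.maximalIdeal O))) := by
  intro H
  obtain ⟨A, hA, hle, hAfg, -, -⟩ :=
    H 2 Nat.prime_two kW KW fg_top OX const_mem_OX rankOne_OX zeroDim_OX OXalg (fun _ hx => hx)
  -- `A = O` as sets
  have hAO : ∀ x : KW, x ∈ A ↔ x ∈ OX :=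
    fun x => ⟨fun hx => hA (A.mem_toSubring.mpr hx), fun hx => hle ((mem_OXalg_iff x).mpr hx)⟩
  -- `↥A` is a finitely generated `𝔽₂`-algebra, hence a Jacobson ring
  haveI : Algebra.FiniteType kW A := A.fg_iff_finiteType.mp hAfg
  haveI : IsJacobsonRing A := isJacobsonRing_of_finiteType (A := kW)
  -- valuation bookkeeping on `↥A`
  have hvle : ∀ a : A, OX.valuation (a : KW) ≤ 1 :=
    fun a => (OX.valuation_le_one_iff _).mpr ((hAO _).mp a.2)
  have hlt_of_nonunit : ∀ a : A, ¬ IsUnit a → OX.valuation (a : KW) < 1 := by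
    intro a ha
    by_contra hlt
    have h1 : OX.valuation (a : KW) = 1 := le_antisymm (hvle a) (not_lt.mp hlt)
    have ha0 : (a : KW) ≠ 0 := by
      intro h0; rw [h0, map_zero] at h1; exact zero_ne_one h1
    have hinv : (a : KW)⁻¹ ∈ A := by
      rw [hAO, ← OX.valuation_le_one_iff, map_inv₀, h1, inv_one]
    exact ha (IsUnit.of_mul_eq_one ⟨(a : KW)⁻¹, hinv⟩ (Subtype.ext (mul_inv_cancel₀ ha0)))
  have nonunit_of_lt : ∀ a : A, OX.valuation (a : KW) < 1 → ¬ IsUnit a := by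
    intro a ha hu
    obtain ⟨b, hb⟩ := hu.exists_right_inv
    have hab : OX.valuation (a : KW) * OX.valuation (b : KW) = 1 := by
      rw [← map_mul, ← Subalgebra.coe_mul, hb, Subalgebra.coe_one, map_one]
    have : OX.valuation (a : KW) * OX.valuation (b : KW) < 1 :=
      calc OX.valuation (a : KW) * OX.valuation (b : KW)
          ≤ OX.valuation (a : KW) * 1 := mul_le_mul_right (hvle b) _
        _ = OX.valuation (a : KW) := mul_one _
        _ < 1 := ha
    exact this.ne hab
  -- hence `↥A` is local …
  haveI : IsLocalRing A := by
    refine IsLocalRing.of_nonunits_add fun a b ha hb => ?_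
    rw [mem_nonunits_iff] at ha hb ⊢
    refine nonunit_of_lt _ (lt_of_le_of_lt (OX.valuation.map_add (a : KW) (b : KW)) ?_)
    exact max_lt (hlt_of_nonunit a ha) (hlt_of_nonunit b hb)
  -- … with maximal ideal `Jac(⊥) = ⊥`
  have hmax : IsLocalRing.maximalIdeal A = ⊥ :=
    (IsLocalRing.jacobson_eq_maximalIdeal (⊥ : Ideal A) bot_ne_top).symm.trans
      (IsJacobsonRing.out ‹_› Ideal.isPrime_bot.isRadical)
  -- but `X` is a non-zero non-unit of `A`
  let XA : A := ⟨RatFunc.X, (hAO _).mpr X_mem_OX⟩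
  have hXlt : OX.valuation (XA : KW) < 1 := by
    rw [← isEquiv_OX.lt_one_iff_lt_one]
    change vX RatFunc.X < 1
    rw [Polynomial.valuation_X_eq_neg_one, ← WithZero.exp_zero, WithZero.exp_lt_exp]
    decide
  have hXmem : XA ∈ IsLocalRing.maximalIdeal A :=
    (IsLocalRing.mem_maximalIdeal _).mpr (mem_nonunits_iff.mpr (nonunit_of_lt XA hXlt))
  rw [hmax, Ideal.mem_bot] at hXmem
  exact RatFunc.X_ne_zero (congrArg Subtype.val hXmem)

/-- (H10) **`R ⊆ O` is load-bearing in the target** (trivially): `R = 𝔽₂[X⁻¹]` at the same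
witness cannot sit below any `A ⊆ O`. [folklore] -/
theorem not_target_without_rle :
    ¬ ∀ p : ℕ, p.Prime → ∀ (k K : Type) [Field k] [CharP k p] [PerfectField k] [Field K]
      [Algebra k K], (⊤ : IntermediateField k K).FG → ∀ O : ValuationSubring K,
        (∀ c : k, algebraMap k K c ∈ O) → Nonempty O.valuation.RankOne →
          (∀ x ∈ O, ∃ f : Polynomial k, f ≠ 0 ∧ Polynomial.aeval x f ∈ O.nonunits) →
            ∀ R : Subalgebra k K, R.FG →
              ∃ (A : Subalgebra k K) (h : A.toSubring ≤ O.toSubring), R ≤ A ∧ A.FG ∧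
                IsFractionRing A K ∧ IsRegularLocalRing (Localization.AtPrime
                  (Ideal.comap (Subring.inclusion h) (IsLocalRing.maximalIdeal O))) := by
  intro H
  obtain ⟨A, hA, hle, -, -, -⟩ :=
    H 2 Nat.prime_two kW KW fg_top OX const_mem_OX rankOne_OX zeroDim_OX
      (Algebra.adjoin kW {(RatFunc.X : KW)⁻¹})
      (Subalgebra.fg_def.mpr ⟨{(RatFunc.X : KW)⁻¹}, Set.finite_singleton _, rfl⟩)
  have h1 : (RatFunc.X : KW)⁻¹ ∈ A := hle (Algebra.subset_adjoin (Set.mem_singleton _))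
  exact inv_X_not_mem_OX (hA (A.mem_toSubring.mpr h1))

/-- (H0) **The algebraic corner is vacuous**: a valuation ring `O ⊇ k` of an ALGEBRAIC extension
`K/k` is all of `K`, so its valuation is trivial and carries no `RankOne` structure (Mathlib's
`Valuation.RankOne` extends `IsNontrivial`). Consequences: the `n = 0` corner of
`DefectlessFramesR` (where `f ≠ 0` forces `K = k(z)` algebraic) and the transcendence-degree-`0`
corner of the target are both EMPTY — the rev-3 repair of the lever is certified, and no
degenerate-dimension refutation of DF, PT or the target exists. [folklore] -/
theorem targetHyps_false_of_isAlgebraic {k K : Type} [Field k] [Field K] [Algebra k K]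
    [Algebra.IsAlgebraic k K] (O : ValuationSubring K) (hk : ∀ c : k, algebraMap k K c ∈ O)
    (hr : Nonempty O.valuation.RankOne) : False := by
  obtain ⟨hr⟩ := hr
  -- every element of `K` is integral over `k ⊆ O`, hence lies in `O` (integrally closed)
  have hO : ∀ x : K, x ∈ O := by
    intro x
    obtain ⟨f, hf, hfx⟩ := (Algebra.IsAlgebraic.isAlgebraic (R := k) x).isIntegral
    let ι : k →+* O :=
      { toFun := fun c => ⟨algebraMap k K c, hk c⟩
        map_one' := Subtype.ext (by simp)
        map_mul' := fun _ _ => Subtype.ext (by simp)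
        map_zero' := Subtype.ext (by simp)
        map_add' := fun _ _ => Subtype.ext (by simp) }
    obtain ⟨y, hy⟩ := IsIntegrallyClosed.algebraMap_eq_of_integral
      (⟨f.map ι, hf.map ι, by rw [Polynomial.eval₂_map]; exact hfx⟩ : IsIntegral O x)
    exact hy ▸ y.2
  -- so the valuation is trivial, contradicting `RankOne ∋ IsNontrivial`
  obtain ⟨x, hx0, hx1⟩ := hr.toIsNontrivial.exists_val_nontrivial
  have hxne : x ≠ 0 := fun h => hx0 (by rw [h, map_zero])
  have hle : O.valuation x ≤ 1 := (O.valuation_le_one_iff x).mpr (hO x)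
  have hge : 1 ≤ O.valuation x := by
    have := (O.valuation_le_one_iff x⁻¹).mpr (hO x⁻¹)
    rw [map_inv₀] at this
    exact (inv_le_one₀ (zero_lt_iff.mpr hx0)).mp this
  exact hx1 (le_antisymm hle hge)

/-- A hypersurface frame with NO transcendental coordinates (`n = 0`) and `f ≠ 0` makes `K/k`
algebraic: `f` is a non-zero polynomial relation for `z`, and `K = k(z)`. [folklore] -/
theorem isAlgebraic_of_frame_zero {k K : Type} [Field k] [Field K] [Algebra k K]
    (y : Fin 0 → K) (z : K) (f : MvPolynomial (Fin (0 + 1)) k)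
    (hadj : IntermediateField.adjoin k (Set.range y ∪ {z}) = ⊤)
    (hker : Ideal.span {f} =
      RingHom.ker (MvPolynomial.aeval (Fin.snoc y z) : MvPolynomial (Fin (0 + 1)) k →ₐ[k] K))
    (hf : f ≠ 0) : Algebra.IsAlgebraic k K := by
  -- `z` is algebraic: the one-variable family `(z)` is not algebraically independent
  have hz : IsAlgebraic k z := by
    haveI : Unique (Fin (0 + 1)) := inferInstanceAs (Unique (Fin 1))
    have hsnoc : (Fin.snoc y z : Fin (0 + 1) → K) = fun _ => z := by
      funext i; rw [Subsingleton.elim i (Fin.last 0), Fin.snoc_last]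
    have hnot : ¬ AlgebraicIndependent k (fun _ : Fin (0 + 1) => z) := by
      intro hind
      have hfker : f ∈ RingHom.ker (MvPolynomial.aeval (Fin.snoc y z) :
          MvPolynomial (Fin (0 + 1)) k →ₐ[k] K) := hker ▸ Ideal.mem_span_singleton_self f
      rw [RingHom.mem_ker, hsnoc] at hfker
      exact hf ((algebraicIndependent_iff_injective_aeval.mp hind) (by rw [map_zero]; exact hfker))
    rw [algebraicIndependent_unique_type_iff] at hnot
    simpa [Transcendental] using hnot
  -- `K = k(z)`
  have htop : IntermediateField.adjoin k {z} = ⊤ := by simpa [Set.range_eq_empty] using hadj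
  haveI : Algebra.IsAlgebraic k (IntermediateField.adjoin k {z}) :=
    IntermediateField.isAlgebraic_adjoin_simple hz.isIntegral
  refine ⟨fun x => ?_⟩
  have hx : x ∈ IntermediateField.adjoin k {z} := htop ▸ IntermediateField.mem_top
  exact IntermediateField.isAlgebraic_iff.mp
    (Algebra.IsAlgebraic.isAlgebraic (⟨x, hx⟩ : IntermediateField.adjoin k {z}))

/-- (H0′) **The `n = 0` corner of `DefectlessFramesR` is empty** at the level of its own binders:
valuation data with `RankOne` plus a frame `(y : Fin 0 → O, z, f)` with `k(z) = K`, `(f) = ker`,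
`f ≠ 0` is contradictory. (So the rev-2 witness family cannot be revived against the repaired
lever, and DF carries no information below `n = 1`.) [folklore] -/
theorem df_frame_zero_vacuous {k K : Type} [Field k] [Field K] [Algebra k K]
    (O : ValuationSubring K) (hk : ∀ c : k, algebraMap k K c ∈ O)
    (hr : Nonempty O.valuation.RankOne) (y : Fin 0 → O) (z : O) (f : MvPolynomial (Fin (0 + 1)) k)
    (hadj : IntermediateField.adjoin k (Set.range (fun i => (y i : K)) ∪ {(z : K)}) = ⊤)
    (hker : Ideal.span {f} = RingHom.ker (MvPolynomial.aeval (Fin.snoc (fun i => (y i : K)) (z : K)) :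
      MvPolynomial (Fin (0 + 1)) k →ₐ[k] K))
    (hf : f ≠ 0) : False :=
  haveI := isAlgebraic_of_frame_zero (fun i => (y i : K)) (z : K) f hadj hker hf
  targetHyps_false_of_isAlgebraic O hk hr

/-! ## §3 The antecedents `DefectlessFramesR` (DF) and `PureTranscendentalFrames` (PT)

A refutation of DF or PT does not refute E — it makes E provable ex falso (rev-2 precedent) and
BREAKS the route; it is the most valuable thing a disprover of this crux can find, so both were
attacked on paper (their `let`-laden signatures make Lean instances expensive; nothing below is
claimed as a theorem).

**DF** — for `(p, k, K, O)` rank-one zero-dimensional over perfect `k` and a hypersurface frame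
`(y : Fin n → O` alg. independent, `z ∈ O`, `k(y,z) = K`, `(f) = ker`, `f ≠ 0)`: a DOMINATING
frame `(y', z')` (`yᵢ, z ∈ k[y', z']`) with `z'` integral and separable over `k[y']`,
`K = k(y', z')`, general position, axis order `s' ≤ s`, and `K / k(y')` DEFECTLESS at `O`
(`[K·k(y')ʰ : k(y')ʰ] = e·f`, typed through the decomposition field).
* `n = 0`: empty (§2 `targetHyps_false_of_isAlgebraic`). `n = 1`: every place of a function
  field of one variable is Abhyankar, `k(y')` is discretely valued with excellent valuation ring,
  so EVERY finite extension is defectless; the content is polynomial domination + `s' ≤ s`, met by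
  Nagata re-framings `y' = y − c zᴺ` (`N > deg f`, `N > s`, `p ∣ N` or `p ∤ N` chosen for
  separability: one of `y, z` lies outside `Kᵖ`) — over FINITE `k` the `s' ≤ s` bookkeeping of
  this particular family can fail for every `c ∈ kˣ` when `z̄ ≠ 0` (the `uˢ`-coefficient is a
  polynomial in `cN z̄ᴺ⁻¹` of degree `≤ s` which may vanish on the few available values); at a
  centre with `z̄ ∈ k` the translation `z ↦ z − z̄` first makes `z̄ = 0`, where that coefficient
  is the constant `β₀ₛ ≠ 0` and `s' = s` exactly; for `z̄ ∉ k` (possible over finite `k`) the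
  family must be enlarged — no kill, but a warning that "generic constant" arguments need care
  over `𝔽_q` (the route allows non-linear Nagata re-framings for exactly this reason).
* `n = 2`, DEPENDENT Artin–Schreier defect is NOT an obstruction. Worked example (Kuhlmann's
  construction): `k` perfect, `σ ∈ k⟦t⟧` transcendental with `σ(0) ≠ 0`, `v` on `K₀ = k(x, y)` by
  `x ↦ t`, `y ↦ σ(t)ᵖ` (so `y^{1/p} ∉ K₀` lies in the completion: purely inseparable defect), and
  `K = K₀(ϑ)`, `ϑᵖ − ϑ = y/x^{pN}` — an immediate AS extension with defect `p` at the unique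
  extension of `v`. The frame `((x, y); w := xᴺϑ)` has `f = Wᵖ − X^{N(p−1)}W − Y`, axis order
  `s = p`, and its projection `k(x,y)` HAS defect — but `K = k(x, w)` is RATIONAL, and the frame
  `(y' := (x, w); z' := 0)` dominates it (`y = wᵖ − x^{N(p−1)}w ∈ k[x,w]`), is integral, separable,
  in general position with `s' = 1 ≤ p`, and trivially defectless (`T = Fh`). DF re-frames the
  defect away exactly as the route intends. A kill of DF therefore needs a place at which EVERY
  separable polynomial projection from inside `O` (of bounded axis order) has INDEPENDENT defect —
  a structural theorem about all transcendence bases inside `O`, not the finite key-polynomial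
  computation on three re-framings proposed in the route header ("CHEAPEST FALSIFIER"): that
  computation can only fail to refute. Nearest literature: Kuhlmann's question whether every
  valued function field admits a transcendence basis `T ⊆ O` with `K/k(T)` defectless
  (inertially / henselian-rationally generated WITHOUT extending `K`; Knaf–Kuhlmann 2005/2009 and
  Temkin 2013 achieve it only after a finite extension of `K`) — open; no counterexample in print
  was found (`lit search` this cycle: see NOTES.md §lit).
* `s = 1` frames are automatically defectless (Hensel in `k(y')ʰ`: simple residual root ⇒
  `[Fh(z'):Fh] ≤ f ≤ e·f ≤ [T:Fh]`), so the content of DF is `n ≥ 2`, `s ≥ 2` (agreeing with the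
  birth vet and the planner).

**PT** — frames of `n+1` algebraically independent elements of `O` (NO generation hypothesis:
`k(x) ⊆ K` may be a proper subfield), `g ≠ 0`; conclusion: dominating alg. independent `x'`,
transported `G`, general position, axis order, and PURITY of `w = x'ₙ` over
`K₁ = k(x'₀, …, x'ₙ₋₁)`: best approximant attained OR for every `q ≠ 0` some `a ∈ K₁` with
`|q(w) − q(a)| < |q(w)|`.
* For LINEAR `q = X − c` the second disjunct is literally the negation of the first, so the
  disjunction's content is: "if the distance of `w` to `K₁` is not attained then `w` is a
  pseudo-limit of TRANSCENDENTAL type" (the degree `≥ 2` clauses).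
* `n = 0`: `K₁ = k`, residues algebraic, the distance is attained (`h` = lift of `w̄` or
  anything) — automatic. `n = 1`: `K₁ = k(x'₀)` is a function field of one variable, its value
  group is discrete of rank one, so a pseudo-Cauchy sequence in `K₁` without best approximant has
  UNBOUNDED values, `w` lies in the completion of `K₁`, and continuity gives the second disjunct —
  automatic again (modulo the general-position re-framing when `axis n x g = 0`). The content of
  PT starts at frames of `≥ 3` elements (`trdeg K ≥ 3`), where bounded pseudo-Cauchy sequences of
  algebraic type in `k(x'₀, x'₁)` exist (the kangaroo phenomenon). No cheap kill: a refutation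
  must show that EVERY dominating re-framing keeps the last variable an algebraic-type limit.
* Cheap trick that does NOT trivialise PT: choosing `x'` with `v(x'ₙ) ∉ ℚ·Γ_{K₁}` makes `h = 0` a
  best approximant, but needs rational rank `≥ 2` on `k(x')`; in the critical rank-one
  rational-rank-one case it is unavailable. -/

/-! ## §4 Candidate stubs: the typed "first lemmas" of the round-1 crux ideas

No skeleton is registered yet (`Lines/` empty, no `PICKED.md`), so the `-- Targets` section is
empty; instead the four idea cards' TYPED first lemmas were attacked as natural sub-claims:

* `henselized-frame-valuation-basis` — `AttainedDistanceOfDefectless`: **FALSE as typed**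
  (`not_attainedDistanceOfDefectless` below). The card transcribed Cutkosky–Mourtada's ADDITIVE
  "`ν*(z − h) = max ν*(z − K)`" literally into Mathlib's MULTIPLICATIVE order, where a best
  approximant MINIMISES `V.valuation (z - h)`; as typed it asks for a MAXIMUM of
  `{V.valuation (z - a) | a ∈ F}`, which does not exist as soon as `V` is non-trivial on `F`
  (`a := X⁻ᴺ·(z − h)`-type elements make it unbounded). Corrected statement C′ =
  `AttainedDistanceOfDefectless'` (direction reversed) — plausible: it is the valuation-basis
  best-approximation lemma (existence of a valuation basis of the defectless `T/F` over a
  henselian `F`, plus card `valuation-basis-best-approximant`'s proved-shape linear algebra).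
  NB the hypotheses of C′ do NOT say `F` is henselian; for non-henselian `F` with several
  extensions of `V ∩ F` to `T` the product `e·f` of ONE extension can still equal `[T:F]` only
  when that extension is the unique one, so C′ is probably fine as stated, but the prover should
  expect to USE uniqueness/henselianity — flagged, not refuted.
* `valuation-basis-best-approximant` — `ValuationBasisBestApprox`: direction correct
  (`≤` = closer, `Finset.sup` = additive min); TRUE by five lines of ultrametric bookkeeping
  (`z − a = (c₀ − a)·1 + Σ_{i≥1} cᵢbᵢ`; residue-new branch: `v(u − a g) = max(v(a)v(g), v(u)) = v(g)`).
  Not attacked further.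
* `rational-absorption-pushdown` — `RationalEngine`, `RationalPushDown`: both have
  summit-implied conclusions (LU at rational / zero-dimensional rank-one places); irrefutable,
  like the crux (§0).
* `inertial-peeling-etale-descent` — `EtaleAscentRelLU`: TRUE in substance (Knaf–Kuhlmann 2009
  Lemma 3.7: `O = (O♭[z])_𝔫` is standard-étale over `O♭`; lift `RelLU` through
  `A := A♭[z, 1/μ'(z), 1/sᵢ(z)]`); no junk instance found (trivial `O`, `k ⊄ O`, reducible `q`
  all harmless). CAUTION on its prose identity `s_P·[κ_b(w̄):κ_b] = Σ_{℘→P} n_℘`: the residue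
  field `κ(v|k(y))` of a zero-dimensional valuation on `k(y)` can be STRICTLY larger than the
  residue field `κ_b = k(ȳ)` of the centre (e.g. `k = 𝔽₂`, `y₁ ↦ t`, `y₂ ↦ θt + t³σ(t)` with
  `θ ∈ 𝔽₄ ∖ 𝔽₂`, `σ` transcendental: `κ(v) = 𝔽₄ ⊋ 𝔽₂ = κ_b`); Hensel factorisation over
  `F = k(y)ʰ` happens over `κ(F) = κ(v|k(y))`, so the identity holds with `[κ(F)(w̄):κ(F)]`, and
  with `κ_b` only after a symmetry argument over the `κ(F)/κ_b`-conjugate factors — to be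
  checked when the line is typed. -/

/-- VERBATIM first lemma of idea card `henselized-frame-valuation-basis` (crux-ideate r1 k2,
`Cruxes/ZariskiCMEngine/Ideas/henselized-frame-valuation-basis.md`, "First lemma"). -/
def AttainedDistanceOfDefectless : Prop :=
  ∀ (Ω : Type) [Field Ω] (V : ValuationSubring Ω) (F T : Subfield Ω), F ≤ T →
    0 < Subfield.relfinrank F T →
    Subfield.relfinrank F T =
      (Literature.AlgebraicGeometry.Resolution.valueSubgroup F V).relIndex
        (Literature.AlgebraicGeometry.Resolution.valueSubgroup T V) *
      (Literature.AlgebraicGeometry.Resolution.residueSubfield F V).relfinrank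
        (Literature.AlgebraicGeometry.Resolution.residueSubfield T V) →
    ∀ z ∈ T, ∃ h ∈ F, ∀ a ∈ F, V.valuation (z - a) ≤ V.valuation (z - h)

/-- **The card's first lemma is FALSE as typed** (stub-misstated: direction of `≤`). Witness:
`Ω = 𝔽₂(X)`, `V = 𝔽₂[X]_{(X)}`, `F = T = ⊤` (so `[T:F] = 1 = e·f`, all hypotheses hold by
`relfinrank_self`/`relIndex_self`), `z = 0`: a maximiser `h` of `a ↦ |0 − a| = |a|` over `𝔽₂(X)`
would bound the valuation, but `|X⁻¹ h| > |h|` (resp. `|1| > |0|` if `h = 0`). The same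
unboundedness kills it for every `z` and every `F` on which `V` is non-trivial — i.e. in every
instance the line wants (`F = k(y')ʰ`, `n ≥ 1`). Repaired statement: `AttainedDistanceOfDefectless'`.
[folklore] -/
theorem not_attainedDistanceOfDefectless : ¬ AttainedDistanceOfDefectless := by
  intro H
  obtain ⟨h, -, hh⟩ := H KW OX ⊤ ⊤ le_rfl (by rw [Subfield.relfinrank_self]; exact one_pos)
    (by rw [Subfield.relfinrank_self, Subgroup.relIndex_self, Subfield.relfinrank_self])
    0 (Subfield.mem_top _)
  by_cases h0 : h = 0
  · have h1 := hh 1 (Subfield.mem_top _)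
    rw [h0, sub_zero, zero_sub, Valuation.map_neg, map_one, map_zero] at h1
    exact absurd h1 (not_le.mpr zero_lt_one)
  · have hvh : OX.valuation h ≠ 0 := (map_ne_zero _).mpr h0
    have h1 := hh ((RatFunc.X : KW)⁻¹ * h) (Subfield.mem_top _)
    rw [zero_sub, zero_sub, Valuation.map_neg, Valuation.map_neg, map_mul] at h1
    have h2 : OX.valuation (RatFunc.X : KW)⁻¹ ≤ 1 :=
      calc OX.valuation (RatFunc.X : KW)⁻¹
          = OX.valuation (RatFunc.X : KW)⁻¹ * OX.valuation h * (OX.valuation h)⁻¹ := by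
            rw [mul_inv_cancel_right₀ hvh]
        _ ≤ OX.valuation h * (OX.valuation h)⁻¹ := mul_le_mul_left h1 _
        _ = 1 := mul_inv_cancel₀ hvh
    exact inv_X_not_mem_OX ((OX.valuation_le_one_iff _).mp h2)

/-- REPAIRED statement C′ (direction of the inequality reversed: `h` is a BEST approximant, i.e.
`|z − h| ≤ |z − a|` for all `a ∈ F`). Plausible — the valuation-basis best-approximation lemma for
a defectless finite `T ⊇ F` (the intended use has `F` henselian, making the extension of `V ∩ F`
to `T` unique); not attacked (no cheap counterexample: at `F = T` take `h = z`; at `e·f = 2`,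
`T = F(θ)`, `z = α + βθ` gives `h = α`). Recorded for the triage panel; NOT a tree statement. -/
def AttainedDistanceOfDefectless' : Prop :=
  ∀ (Ω : Type) [Field Ω] (V : ValuationSubring Ω) (F T : Subfield Ω), F ≤ T →
    0 < Subfield.relfinrank F T →
    Subfield.relfinrank F T =
      (Literature.AlgebraicGeometry.Resolution.valueSubgroup F V).relIndex
        (Literature.AlgebraicGeometry.Resolution.valueSubgroup T V) *
      (Literature.AlgebraicGeometry.Resolution.residueSubfield F V).relfinrank
        (Literature.AlgebraicGeometry.Resolution.residueSubfield T V) →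
    ∀ z ∈ T, ∃ h ∈ F, ∀ a ∈ F, V.valuation (z - h) ≤ V.valuation (z - a)

/-- Sanity of C′ in the degenerate slice the witness above used (`F = T`): there `h = z` works,
so the repaired statement is NOT hit by the unboundedness witness. [folklore] -/
theorem attainedDistanceOfDefectless'_self (Ω : Type) [Field Ω] (V : ValuationSubring Ω)
    (F : Subfield Ω) : ∀ z ∈ F, ∃ h ∈ F, ∀ a ∈ F, V.valuation (z - h) ≤ V.valuation (z - a) :=
  fun z hz => ⟨z, hz, fun a _ => by rw [sub_self, map_zero]; exact zero_le⟩

/-! ## -- Targets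

None at this cycle: `ledger crux ls` shows only `Ideas/` (4 cards of ideation round 1); no
`Lines/*.lean`, no `PICKED.md`, `payload.stuck_stubs = []`. On re-arm, the picked line's stubs go
here as `theorem <stub>_false : ¬ … ` attempts.

## §5 Regimes tried (cycle 1) and why none bites; what WOULD kill

* Junk models of the target: trivial valuation `O = K` and algebraic `K` — excluded by
  `RankOne ∋ IsNontrivial` (§2); residue-transcendental `O` — excluded by zero-dimensionality;
  `IsRegularLocalRing` is Mathlib's (Noetherian + local + embdim = dim), `IsFractionRing ↥A K`
  uses `Subalgebra.toAlgebra` — faithful; no typing junk found (re-read symbol by symbol).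
* Natural strengthenings of the target with summit-implied conclusions (`IsRegularRing ↥A`,
  dropping rank one / zero-dim / perfectness, `A` an affine open of a resolution) — irrefutable;
  strengthening to "`A` a HYPERSURFACE ring `k[y', z']` containing `R`" is NOT obviously
  summit-implied (an arbitrary f.g. `R ⊆ O` need not embed in a monogenic order `k[y'][z']`
  inside `O`: for `n = 1` and `R = 𝒪(C ∖ S)` the ring `k[y', z'] ⊇ R` is forced to be an
  integrally closed overring, i.e. a CLOSED PLANE model of a punctured `C`, which needs at least
  `Ω_{C∖S''}` trivial); the engine must therefore NOT try to immerse `R` in a frame ring — the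
  standard route is: uniformize ONE hypersurface frame of `K` (primitive element), then absorb the
  finitely many generators `rᵢ = aᵢ/bᵢ` of `R` by embedded LU of `∏ aᵢbᵢ` on the regular model plus
  Perron's positive-basis lemma (`v(rᵢ) ≥ 0` ⇒ the monomial of `bᵢ` divides that of `aᵢ`), which
  is exactly where `R.FG` (§2, load-bearing) and ELU one dimension UP (CM: "ELU in dimension m
  implies LU in dimension m−1 for hypersurfaces, which implies LU … by the primitive element
  theorem", arXiv:1711.02726 p. 4) are consumed — so the port needs Zariski's FULL double
  induction (LRMₘ ⇒ ELUₘ₊₁ as well as ELUₘ ⇒ LRMₘ), not Thm 7.1 alone.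
* Literature this cycle (search-degraded: local index resetting, OpenAlex 429, galaxy 0-hit;
  arXiv only): CM2019 p. 4 states the lever as a standing ASSUMPTION ("if … a suitable linear
  projection … can always be found such that … the defect δ(ν/ω) = 0, then local uniformization
  holds in K") and proves nothing about its existence; no printed counterexample to the existence
  of defectless rational projections from inside `O` was found (Kuhlmann-type open question);
  arXiv:1904.10702 (Cutkosky–Mourtada–Teissier, generating sequences on hypersurface
  singularities) is the nearest constructive text for the prover.
* DF: `n = 0, 1`, `s = 1`, purely inseparable projections, dependent AS defect (§3) — no kill.
* PT: `n = 0, 1`, rational-rank escape (§3) — no kill.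
* Idea stubs: one kill (§4).
* WOULD KILL E: only `DF ∧ PT ∧ ¬LU` (`not_engine_iff`). WOULD BREAK THE ROUTE (E ex falso): a
  valued function field `(K, O)` of `trdeg 2` or `3` over a perfect field with a genuine frame all
  of whose dominating separable integral re-framings of axis order `≤ s` carry defect at `O`
  (refutes DF), or a frame of `≥ 3` algebraically independent elements all of whose dominating
  re-framings leave the last variable an unattained algebraic-type pseudo-limit (refutes PT).
  Neither is a finite computation; both are open questions of Kuhlmann type. -/

end

end Summit.ResolutionOfSingularities.ResolutionOfSingularities.Cruxes.ZariskiCMEngine.Disproof
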